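import Summits.CriticalPhenomena.PercolationContinuityZ3.Theorems.PercNearOneGluingNoHeavyLowerTailBlockQ9AnchoredDecomposition
import Summits.CriticalPhenomena.PercolationContinuityZ3.Theorems.PercNearOneGluingNoHeavyLowerTailSeqExchange
import HarnessLib

/-!
# `NoHeavyLowerTail` (stmt-CriticalPhenomena-4575) — Question 9 for a glued one-layer block with three dangerous pairs
# from a PURE PEELING ORDER (the sequential leaf of the hybrid 'transfer ∨ certificate')

Support file (hull-port / coupling seat `prim-hp-1` gen 12; `--supports stmt-CriticalPhenomena-4575`).
No definitions, no named facts, no sorries.  Memo `run/shared/lean/prim/prim-hp-1/HULLPORT-COUPLING.md` §52(h).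

Three dangerous boundary pairs `e_j = s(p_j, q_j)` (`j : Fin 3`) of a glued one-layer block.  The PEELING ORDER `(0,1,2)`
decomposes the law of the three pairs on "some pair open" as `ρ₀·[e₀ ↦ 1] + (1−ρ₀)ρ₁·[e₁ ↦ 1, e₀ ↦ 0] +
(1−ρ₀)(1−ρ₁)ρ₂·[e₂ ↦ 1, e₀ ↦ 0, e₁ ↦ 0]` ("first open pair"); the three anchored components are
`W₀ = w[e₀ ↦ 1]`, `W₁ = w[e₁ ↦ 1, e₀ ↦ 0]`, `W₂ = w[e₂ ↦ 1, e₀ ↦ 0, e₁ ↦ 0]`.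

* `BlockQ9.blockQ9_threeDangerous_of_pureOrder` — if `a` is dominated by `p₀` in `w` (then `W₀` is valid by Lemma 3(i)),
  by `p₁` in `W₁` and by `p₂` in `W₂`, then Question 9 holds for the block (`BlockQ9.blockQ9_of_anchoredDecomposition`
  with these three components).  This is the three-pair analogue of `BlockQ9.blockQ9_twoDangerousPorts` and the
  transitive-tournament corner of `BlockQ9.blockQ9_threeDangerous_of_tournament` without its glued component.  Role
  (memo §52(h)): in all data a block that is NOT certified by the transfer leaf (`BlockQ9.blockQ9_of_transfer` with the
  K-weakest port) is certified by some peeling order — the anchored-product family as a whole is incomplete (exact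
  counterexample, single hub), so the two leaves are complementary.  Relabel `p, q` to use another order.
[cite: KozmaNitzan2024, Lemma 3(i) (pp. 6–7), Lemma 5 (p. 13), Thm. 4 (pp. 12–14), Question 9 (p. 36)]
-/

namespace Summit.CriticalPhenomena.PercolationContinuityZ3.Theorems

open MeasureTheory Set
open Literature.Probability.LatticeModels
open Literature.Probability.Percolation

noncomputable section
open Classical

namespace BlockQ9

variable {n : ℕ}

/-- **Question 9 for a glued one-layer block with three dangerous pairs, from the peeling order `(0,1,2)`.**
See the file header: `hyp₀` is domination in `w`, `hval₁`/`hval₂` the validities of the second and third peeled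
components. [cite: KozmaNitzan2024, Lemma 3(i) (pp. 6–7), Lemma 5 (p. 13), Thm. 4 (pp. 12–14), Question 9 (p. 36);
this work (memo §52(h))] -/
theorem blockQ9_threeDangerous_of_pureOrder (w : Sym2 (Fin n) → unitInterval) (O A : Finset (Fin n))
    (a b : Fin n) (hOA : Disjoint O A) (haO : a ∉ O) (hbO : b ∉ O)
    (hiso : ∀ x ∈ O, ∀ y : Fin n, y ∉ O → y ∉ A → w s(x, y) = 0)
    (p q : Fin 3 → Fin n) (hq : ∀ j, q j ∈ O) (hpA : ∀ j, p j ∈ A) (hpO : ∀ j, p j ∉ O)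
    (hinj : Function.Injective fun j => s(p j, q j))
    (hpos : 0 < (w s(p 0, q 0) : ℝ))
    (hdom : ∀ v ∈ A, ∀ o ∈ O, w s(o, v) ≠ 0 → (∀ j, s(o, v) ≠ s(p j, q j)) →
      (prodBernoulli (fun e : Sym2 (Fin n) => if (∃ x ∈ e, x ∈ O) then 0 else w e)).real (openConn a b) ≤
        (prodBernoulli (fun e : Sym2 (Fin n) => if (∃ x ∈ e, x ∈ O) then 0 else w e)).real (openConn v b))
    (hyp₀ : (prodBernoulli w).real (openConn a b) ≤ (prodBernoulli w).real (openConn (p 0) b))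
    (hval₁ : (prodBernoulli (Function.update (Function.update w s(p 1, q 1) 1) s(p 0, q 0) 0)).real (openConn a b) ≤
      (prodBernoulli (Function.update (Function.update w s(p 1, q 1) 1) s(p 0, q 0) 0)).real (openConn (p 1) b))
    (hval₂ : (prodBernoulli (Function.update (Function.update (Function.update w s(p 2, q 2) 1) s(p 0, q 0) 0)
        s(p 1, q 1) 0)).real (openConn a b) ≤
      (prodBernoulli (Function.update (Function.update (Function.update w s(p 2, q 2) 1) s(p 0, q 0) 0)
        s(p 1, q 1) 0)).real (openConn (p 2) b)) :
    (prodBernoulli (fun e : Sym2 (Fin n) => if (∀ x ∈ e, x ∈ O) ∧ ¬ e.IsDiag then 1 else w e)).real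
        (openConn a b ∩ ⋃ o ∈ O, ⋃ x ∈ A, openConn o x) ≤
      (prodBernoulli (fun e : Sym2 (Fin n) => if (∀ x ∈ e, x ∈ O) ∧ ¬ e.IsDiag then 1 else w e)).real
        (⋃ o ∈ O, openConn o b) := by
  set e : Fin 3 → Sym2 (Fin n) := fun j => s(p j, q j) with he
  set F : Finset (Sym2 (Fin n)) := Finset.univ.image e with hF
  set ρ : Fin 3 → ℝ := fun j => (w (e j) : ℝ) with hρ
  have hρ0 : ∀ j, 0 ≤ ρ j := fun j => (w (e j)).2.1
  have hρ1 : ∀ j, ρ j ≤ 1 := fun j => (w (e j)).2.2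
  have h01 : e 0 ≠ e 1 := fun h => absurd (hinj h) (by decide)
  have h02 : e 0 ≠ e 2 := fun h => absurd (hinj h) (by decide)
  have h12 : e 1 ≠ e 2 := fun h => absurd (hinj h) (by decide)
  -- the three components and their masses
  set r : Fin 3 → Sym2 (Fin n) → unitInterval := fun j =>
    if j = 0 then Function.update w (e 0) 1
    else if j = 1 then Function.update (Function.update w (e 1) 1) (e 0) 0
    else Function.update (Function.update (Function.update w (e 2) 1) (e 0) 0) (e 1) 0 with hr
  set c : Fin 3 → ℝ := fun j =>
    if j = 0 then ρ 0 else if j = 1 then (1 - ρ 0) * ρ 1 else (1 - ρ 0) * (1 - ρ 1) * ρ 2 with hc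
  have hr0 : r 0 = Function.update w (e 0) 1 := by simp [hr]
  have hr1 : r 1 = Function.update (Function.update w (e 1) 1) (e 0) 0 := by simp [hr]
  have hr2 : r 2 = Function.update (Function.update (Function.update w (e 2) 1) (e 0) 0) (e 1) 0 := by simp [hr]
  have heF : ∀ j, e j ∈ F := fun j => Finset.mem_image.2 ⟨j, Finset.mem_univ _, rfl⟩
  have hFform : ∀ f ∈ F, ∃ p' s₀ : Fin n, f = s(p', s₀) ∧ s₀ ∈ O ∧ p' ∈ A ∧ p' ∉ O := by
    intro f hf
    obtain ⟨j, -, rfl⟩ := Finset.mem_image.1 hf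
    exact ⟨p j, q j, rfl, hq j, hpA j, hpO j⟩
  have hnotF : ∀ f, f ∉ F ↔ ∀ j, f ≠ s(p j, q j) := by
    intro f
    simp only [hF, Finset.mem_image, Finset.mem_univ, true_and, not_exists]
    exact ⟨fun h j hfj => h j hfj.symm, fun h j hj => h j hj.symm⟩
  -- validity of the first component: Lemma 3(i)
  have hval₀ : (prodBernoulli (Function.update w (e 0) 1)).real (openConn a b) ≤
      (prodBernoulli (Function.update w (e 0) 1)).real (openConn (p 0) b) := by
    have hps : p 0 ≠ q 0 := fun h => hpO 0 (h ▸ hq 0)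
    have hyp' : (prodBernoulli w).real (openConn a b) ≤ (prodBernoulli w).real (openConn (p 0) b) + 0 := by
      rw [add_zero]; exact hyp₀
    have L := SeqExchange.lemma3i_pair w a (p 0) (q 0) b hps le_rfl hyp'
    rw [zero_mul, add_zero, goodStepEI_real_inter_open_eq w s(p 0, q 0),
      goodStepEI_real_inter_open_eq w s(p 0, q 0)] at L
    exact le_of_mul_le_mul_left L hpos
  refine blockQ9_of_anchoredDecomposition w O A a b hOA haO hbO hiso F hFform ?_ Finset.univ p q r c
    ?_ ?_ ?_ ?_ ?_ ?_ ?_ ?_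
  · intro v hv o ho hne hnot
    exact hdom v hv o ho hne ((hnotF _).1 hnot)
  · intro j _; exact heF j
  · intro j _; exact hq j
  · intro j _; exact hpO j
  · -- anchors forced open
    intro j _
    fin_cases j
    · show r 0 (e 0) = 1
      rw [hr0, Function.update_self]
    · show r 1 (e 1) = 1
      rw [hr1, Function.update_of_ne h01.symm, Function.update_self]
    · show r 2 (e 2) = 1
      rw [hr2, Function.update_of_ne h12.symm, Function.update_of_ne h02.symm, Function.update_self]
  · -- off `F` the components agree with `w`
    intro j _ f hf
    have hf0 : f ≠ e 0 := by rw [he]; exact ((hnotF f).1 hf) 0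
    have hf1 : f ≠ e 1 := by rw [he]; exact ((hnotF f).1 hf) 1
    have hf2 : f ≠ e 2 := by rw [he]; exact ((hnotF f).1 hf) 2
    fin_cases j
    · show r 0 f = w f
      rw [hr0, Function.update_of_ne hf0]
    · show r 1 f = w f
      rw [hr1, Function.update_of_ne hf0, Function.update_of_ne hf1]
    · show r 2 f = w f
      rw [hr2, Function.update_of_ne hf1, Function.update_of_ne hf0, Function.update_of_ne hf2]
  · -- masses nonnegative
    intro j _
    fin_cases j
    · show 0 ≤ c 0
      simp only [hc]; exact hρ0 0
    · show 0 ≤ c 1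
      simp only [hc]; exact mul_nonneg (by linarith [hρ1 0]) (hρ0 1)
    · show 0 ≤ c 2
      simp only [hc]
      exact mul_nonneg (mul_nonneg (by linarith [hρ1 0]) (by linarith [hρ1 1])) (hρ0 2)
  · -- validity
    intro j _
    fin_cases j
    · show (prodBernoulli (r 0)).real (openConn a b) ≤ (prodBernoulli (r 0)).real (openConn (p 0) b)
      rw [hr0]; exact hval₀
    · show (prodBernoulli (r 1)).real (openConn a b) ≤ (prodBernoulli (r 1)).real (openConn (p 1) b)
      rw [hr1]; exact hval₁
    · show (prodBernoulli (r 2)).real (openConn a b) ≤ (prodBernoulli (r 2)).real (openConn (p 2) b)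
      rw [hr2]; exact hval₂
  · -- covering identity: "first open pair"
    intro T hT hTne
    have hTsub : T ⊆ F := Finset.mem_powerset.1 hT
    have hprod : ∀ g : Sym2 (Fin n) → ℝ, ∏ f ∈ F, g f = g (e 0) * g (e 1) * g (e 2) := by
      intro g
      rw [hF, Finset.prod_image (fun j _ k _ h => hinj h), Fin.prod_univ_three]
    have hw : ∀ j, ((w (e j) : unitInterval) : ℝ) = ρ j := fun j => rfl
    -- values of the components on the three pairs
    have v00 : ((r 0 (e 0) : unitInterval) : ℝ) = 1 := by rw [hr0, Function.update_self]; rfl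
    have v01 : ((r 0 (e 1) : unitInterval) : ℝ) = ρ 1 := by rw [hr0, Function.update_of_ne h01.symm]
    have v02 : ((r 0 (e 2) : unitInterval) : ℝ) = ρ 2 := by rw [hr0, Function.update_of_ne h02.symm]
    have v10 : ((r 1 (e 0) : unitInterval) : ℝ) = 0 := by rw [hr1, Function.update_self]; rfl
    have v11 : ((r 1 (e 1) : unitInterval) : ℝ) = 1 := by
      rw [hr1, Function.update_of_ne h01.symm, Function.update_self]; rfl
    have v12 : ((r 1 (e 2) : unitInterval) : ℝ) = ρ 2 := by
      rw [hr1, Function.update_of_ne h02.symm, Function.update_of_ne h12.symm]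
    have v20 : ((r 2 (e 0) : unitInterval) : ℝ) = 0 := by
      rw [hr2, Function.update_of_ne h01, Function.update_self]; rfl
    have v21 : ((r 2 (e 1) : unitInterval) : ℝ) = 0 := by rw [hr2, Function.update_self]; rfl
    have v22 : ((r 2 (e 2) : unitInterval) : ℝ) = 1 := by
      rw [hr2, Function.update_of_ne h12.symm, Function.update_of_ne h02.symm, Function.update_self]; rfl
    rw [Fin.sum_univ_three]
    simp only [hprod]
    have c0 : c 0 = ρ 0 := by simp [hc]
    have c1 : c 1 = (1 - ρ 0) * ρ 1 := by simp [hc]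
    have c2 : c 2 = (1 - ρ 0) * (1 - ρ 1) * ρ 2 := by simp [hc]
    rw [c0, c1, c2]
    have hcontra : ¬ (e 0 ∉ T ∧ e 1 ∉ T ∧ e 2 ∉ T) := by
      rintro ⟨a0, a1, a2⟩
      obtain ⟨f, hf⟩ := hTne
      obtain ⟨j, -, rfl⟩ := Finset.mem_image.1 (hTsub hf)
      fin_cases j
      · exact a0 hf
      · exact a1 hf
      · exact a2 hf
    have hmemT : ∀ j, e j ∈ T ∨ e j ∉ T := fun j => Classical.em _
    rcases hmemT 0 with h0 | h0 <;> rcases hmemT 1 with h1 | h1 <;> rcases hmemT 2 with h2 | h2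
    all_goals first
      | (exfalso; exact hcontra ⟨h0, h1, h2⟩)
      | (simp only [h0, h1, h2, if_true, if_false, hw, v00, v01, v02, v10, v11, v12, v20, v21, v22]; ring)

end BlockQ9

end

end Summit.CriticalPhenomena.PercolationContinuityZ3.Theorems
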